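/-
Copyright: statement-level skeleton of a published paper (lit-balaban cell, Phase-2 proof seat p25, gen 16). No proof
claims beyond what the kernel checks below.
-/
import Literature.MathematicalPhysics.QuantumFieldTheory.BalabanImbrieJaffe1984to88.BIJ88LabelledRun311

/-!
# `BalabanImbrieJaffe1984to88.BIJ88LabelledRunEnv311` — T. Bałaban, J. Imbrie, A. Jaffe, *Effective action and cluster
properties of the abelian Higgs model*, Commun. Math. Phys. **114** (1988) 257–315 [BalabanImbrieJaffe1988], §5.14
p. 311–312 [PDF 55–56] *"We can arrange the construction so that the {X_c} are determined once the remainder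
components are specified. Summing all possible diagrams in X_c gives the observable for the next step there,
F^L_{k+1,loc}(X_c)."* — **WHAT A RUN SEES: INVARIANTS AND THE TWO ENVIRONMENT LEMMAS** for the labelled run `run` of
`BIJ88LabelledRun311` (p25 gen 16).  The mechanism behind print's sentence, for contraction-graph components: the run
of a component touches only the observables it absorbs, so (I) the outcomes leaving a sub-environment untouched are
the outcomes of the run in the smaller environment, and (II) a CONSTANT outcome (no `χ′`, fewer than `m̄+1` vertices,
all legs contracted) never absorbed a complete component set aside nor contracted to `χ′` — the constant components
are assembled from pristine observables alone, independently of everything else.  These are the two inputs of the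
resummation `Σ Π_c F^L(X_c) ⟨Π_r F_rem(X_r)⟩` (sibling `BIJ88Resummation312`).

statement-level skeleton of published theorems with citation tags; proofs where landed; nothing here is a claim
about the Yang–Mills mass gap

PDF held: `paper:balaban1988-cmp114-bij-abelian-higgs-effective-action` (journal page = PDF page + 256); p. 311–312 =
PDF 55–56 (`p0055.txt` L23–38, `p0056.txt` L1–9 re-read this session).

CITATION HEADER (lean-in-tree rule).  lit-balaban cell (HOME `run/shared/lean/pub/lit-balaban/`), Phase 2, seat p25
gen 16; row **C2.Claim@312** of `HOME/lit-balaban-r16/ROWS-C2-part2.md` (owner r16, referee ref-5; head untouched).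
USED BY NAME, nothing restated: `BIJ88LabelledRun311.{LGrp, Outcome, fbind, mbind, rpot, run, run_of_complete,
run_of_not_complete, rpot_*}` (this seat and generation), `BIJ88VertexComponents311.{Grp.complete, Grp.IsConst,
maxArity, Grp.nv_lt_of_not_complete, Grp.pend_ne_nil_of_not_complete}` (p25 gen 15).

## What is proved (0 `sorry`, standard axioms, no new `Prop` facts, no new definitions)

* §3 **`run_ind`** (induction along a run, the six events mirrored), `run_rest_subset`, `run_done_le`,
  `run_complete`, `run_mono` (the `χ′`-count, the vertex count and the labels only grow), `isRem_of_complete_of_lt`,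
  **`run_const`** (a constant outcome: `o.D = []` and `o.done = done`), `run_lab` (labels conserved:
  `o.g.lab ∪ ⋃ o.done.lab ∪ o.rest = g.lab ∪ ⋃ done.lab ∪ rest`).
* §4 `erase_sdiff_erase_eq`, **`run_filter_env`** (ENVIRONMENT LEMMA I: for `B ⊆ rest`,
  `(run g rest done).filter (rest ∖ B ⊆ ·.rest) = (run g B done).map (·.rest ∪= rest ∖ B)`), **`run_filter_const`**
  (ENVIRONMENT LEMMA II: `(run g rest done).filter const = ((run g rest 0).filter const).map (·.done := done)` when the
  components of `done` are complete).
HONEST SCOPE: as in `BIJ88LabelledRun311`.  NOT summit progress; NOT continuum; NOT Clay.  Imports `BIJ88LabelledRun311`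
only; modifies nothing.
-/

noncomputable section

namespace Literature.MathematicalPhysics.QuantumFieldTheory.BalabanImbrieJaffe1984to88.BIJ88LabelledRunEnv311

open Classical Matrix Finset
open scoped BigOperators
open BIJ88VertexComponents311 (Grp maxArity length_legs_le)
open BIJ88LabelledRun311

variable {S : Type} [Fintype S] {ι : Type} [Fintype ι] {κ : Type} [DecidableEq S] [DecidableEq κ]

/-! ## §3  Invariants along a run -/

section Invariants

variable {A : Matrix S S ℝ} {f : S → ℝ} {c : ι → ℝ} {legs : ι → List (S → ℝ)} {obs : κ → List (S → ℝ)} {M : ℕ}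

/-- **Induction along a run** (the six events of p. 311, mirrored): a property of (state, outcome) that holds for the
outcome "set aside" and is carried backwards through each of the six contractions holds for every outcome of every run.
[cite: BalabanImbrieJaffe1988, §5.14 p.311] -/
theorem run_ind {P : LGrp S κ → Finset κ → Multiset (LGrp S κ) → Outcome S κ → Prop}
    (hset : ∀ g rest done, g.complete M = true → P g rest done ⟨1, [], 0, g, rest, done⟩)
    (hpair : ∀ (g : LGrp S κ) rest done u L, ¬ g.complete M = true → g.pend = u :: L → ∀ i,
      ∀ o ∈ run A f c legs obs M ⟨⟨L.eraseIdx i, g.nchi, g.nv⟩, g.lab⟩ rest done,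
        P ⟨⟨L.eraseIdx i, g.nchi, g.nv⟩, g.lab⟩ rest done o → P g rest done (o.scale ((A⁻¹ *ᵥ u) ⬝ᵥ L.getD i 0)))
    (hprist : ∀ (g : LGrp S κ) rest done u L, ¬ g.complete M = true → g.pend = u :: L → ∀ j ∈ rest, ∀ i,
      ∀ o ∈ run A f c legs obs M ⟨⟨L ++ (obs j).eraseIdx i, g.nchi, g.nv⟩, g.lab ∪ {j}⟩ (rest.erase j) done,
        P ⟨⟨L ++ (obs j).eraseIdx i, g.nchi, g.nv⟩, g.lab ∪ {j}⟩ (rest.erase j) done o →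
          P g rest done (o.scale ((A⁻¹ *ᵥ u) ⬝ᵥ (obs j).getD i 0)))
    (habs : ∀ (g : LGrp S κ) rest done u L, ¬ g.complete M = true → g.pend = u :: L → ∀ h ∈ done,
      ∀ i < h.pend.length, ∀ o ∈ run A f c legs obs M (LGrp.absorb L g h i) rest (done.erase h),
        P (LGrp.absorb L g h i) rest (done.erase h) o → P g rest done (o.scale ((A⁻¹ *ᵥ u) ⬝ᵥ h.pend.getD i 0)))
    (hsrc : ∀ (g : LGrp S κ) rest done u L, ¬ g.complete M = true → g.pend = u :: L →
      ∀ o ∈ run A f c legs obs M ⟨⟨L, g.nchi, g.nv⟩, g.lab⟩ rest done,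
        P ⟨⟨L, g.nchi, g.nv⟩, g.lab⟩ rest done o → P g rest done (o.scale ((A⁻¹ *ᵥ u) ⬝ᵥ f)))
    (hchi : ∀ (g : LGrp S κ) rest done u L, ¬ g.complete M = true → g.pend = u :: L →
      ∀ o ∈ run A f c legs obs M ⟨⟨L, g.nchi + 1, g.nv⟩, g.lab⟩ rest done,
        P ⟨⟨L, g.nchi + 1, g.nv⟩, g.lab⟩ rest done o → P g rest done (o.push (A⁻¹ *ᵥ u)))
    (hvert : ∀ (g : LGrp S κ) rest done u L, ¬ g.complete M = true → g.pend = u :: L → ∀ m j,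
      ∀ o ∈ run A f c legs obs M ⟨⟨L ++ (legs m).eraseIdx j, g.nchi, g.nv + 1⟩, g.lab⟩ rest done,
        P ⟨⟨L ++ (legs m).eraseIdx j, g.nchi, g.nv + 1⟩, g.lab⟩ rest done o →
          P g rest done ((o.scale (-(c m * ((A⁻¹ *ᵥ u) ⬝ᵥ (legs m).getD j 0)))).bump)) :
    ∀ (n : ℕ) (g : LGrp S κ) (rest : Finset κ) (done : Multiset (LGrp S κ)),
      rpot obs M (maxArity legs) g rest done < n → ∀ o ∈ run A f c legs obs M g rest done, P g rest done o
  | 0, _, _, _, hn => absurd hn (Nat.not_lt_zero _)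
  | n + 1, g, rest, done, hn => by
    intro o ho
    have hn' : rpot obs M (maxArity legs) g rest done ≤ n := Nat.lt_succ_iff.1 hn
    have IH : ∀ g' rest' done', rpot obs M (maxArity legs) g' rest' done' < rpot obs M (maxArity legs) g rest done →
        ∀ o ∈ run A f c legs obs M g' rest' done', P g' rest' done' o :=
      fun g' rest' done' hlt => run_ind hset hpair hprist habs hsrc hchi hvert n g' rest' done' (lt_of_lt_of_le hlt hn')
    rw [run] at ho
    split at ho
    · rename_i hc
      rw [Multiset.mem_singleton] at ho
      subst ho
      exact hset g rest done hc
    · rename_i hc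
      split at ho
      · exact absurd ho (Multiset.notMem_zero _)
      · rename_i u L hp
        have hnv : g.nv < M := Grp.nv_lt_of_not_complete hc
        simp only [Multiset.mem_add, Multiset.mem_bind, Multiset.mem_map, Finset.mem_val, Finset.mem_range,
          mem_fbind, mem_mbind, Finset.mem_univ, true_and] at ho
        rcases ho with (((((⟨i, -, o', ho', rfl⟩ | ⟨j, hj, i, -, o', ho', rfl⟩) | ⟨h, hh, i, hi, o', ho', rfl⟩) |
          ⟨o', ho', rfl⟩) | ⟨o', ho', rfl⟩) | ⟨m, j, -, o', ho', rfl⟩)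
        · exact hpair g rest done u L hc hp i o' ho' (IH _ _ _ (rpot_pair obs M _ rest done hp i) o' ho')
        · exact hprist g rest done u L hc hp j hj i o' ho' (IH _ _ _ (rpot_pristine obs M _ rest done hp hj i _) o' ho')
        · exact habs g rest done u L hc hp h hh i hi o' ho' (IH _ _ _ (rpot_absorb obs M _ rest done hp hh i) o' ho')
        · exact hsrc g rest done u L hc hp o' ho' (IH _ _ _ (rpot_drop obs M _ rest done hp _) o' ho')
        · exact hchi g rest done u L hc hp o' ho' (IH _ _ _ (rpot_drop obs M _ rest done hp _) o' ho')
        · exact hvert g rest done u L hc hp m j o' ho' (IH _ _ _ (rpot_vertex obs M rest done legs hp hnv m j) o' ho')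

/-- Shorthand: the conclusion of `run_ind` for every state. [cite: BalabanImbrieJaffe1988, §5.14 p.311] -/
theorem run_ind' {P : LGrp S κ → Finset κ → Multiset (LGrp S κ) → Outcome S κ → Prop}
    (hset : ∀ g rest done, g.complete M = true → P g rest done ⟨1, [], 0, g, rest, done⟩)
    (hpair : ∀ (g : LGrp S κ) rest done u L, ¬ g.complete M = true → g.pend = u :: L → ∀ i,
      ∀ o ∈ run A f c legs obs M ⟨⟨L.eraseIdx i, g.nchi, g.nv⟩, g.lab⟩ rest done,
        P ⟨⟨L.eraseIdx i, g.nchi, g.nv⟩, g.lab⟩ rest done o → P g rest done (o.scale ((A⁻¹ *ᵥ u) ⬝ᵥ L.getD i 0)))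
    (hprist : ∀ (g : LGrp S κ) rest done u L, ¬ g.complete M = true → g.pend = u :: L → ∀ j ∈ rest, ∀ i,
      ∀ o ∈ run A f c legs obs M ⟨⟨L ++ (obs j).eraseIdx i, g.nchi, g.nv⟩, g.lab ∪ {j}⟩ (rest.erase j) done,
        P ⟨⟨L ++ (obs j).eraseIdx i, g.nchi, g.nv⟩, g.lab ∪ {j}⟩ (rest.erase j) done o →
          P g rest done (o.scale ((A⁻¹ *ᵥ u) ⬝ᵥ (obs j).getD i 0)))
    (habs : ∀ (g : LGrp S κ) rest done u L, ¬ g.complete M = true → g.pend = u :: L → ∀ h ∈ done,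
      ∀ i < h.pend.length, ∀ o ∈ run A f c legs obs M (LGrp.absorb L g h i) rest (done.erase h),
        P (LGrp.absorb L g h i) rest (done.erase h) o → P g rest done (o.scale ((A⁻¹ *ᵥ u) ⬝ᵥ h.pend.getD i 0)))
    (hsrc : ∀ (g : LGrp S κ) rest done u L, ¬ g.complete M = true → g.pend = u :: L →
      ∀ o ∈ run A f c legs obs M ⟨⟨L, g.nchi, g.nv⟩, g.lab⟩ rest done,
        P ⟨⟨L, g.nchi, g.nv⟩, g.lab⟩ rest done o → P g rest done (o.scale ((A⁻¹ *ᵥ u) ⬝ᵥ f)))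
    (hchi : ∀ (g : LGrp S κ) rest done u L, ¬ g.complete M = true → g.pend = u :: L →
      ∀ o ∈ run A f c legs obs M ⟨⟨L, g.nchi + 1, g.nv⟩, g.lab⟩ rest done,
        P ⟨⟨L, g.nchi + 1, g.nv⟩, g.lab⟩ rest done o → P g rest done (o.push (A⁻¹ *ᵥ u)))
    (hvert : ∀ (g : LGrp S κ) rest done u L, ¬ g.complete M = true → g.pend = u :: L → ∀ m j,
      ∀ o ∈ run A f c legs obs M ⟨⟨L ++ (legs m).eraseIdx j, g.nchi, g.nv + 1⟩, g.lab⟩ rest done,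
        P ⟨⟨L ++ (legs m).eraseIdx j, g.nchi, g.nv + 1⟩, g.lab⟩ rest done o →
          P g rest done ((o.scale (-(c m * ((A⁻¹ *ᵥ u) ⬝ᵥ (legs m).getD j 0)))).bump))
    (g : LGrp S κ) (rest : Finset κ) (done : Multiset (LGrp S κ)) :
    ∀ o ∈ run A f c legs obs M g rest done, P g rest done o :=
  run_ind hset hpair hprist habs hsrc hchi hvert _ g rest done (Nat.lt_succ_self _)

/-- **The untouched observables of an outcome were in the environment.** [cite: BalabanImbrieJaffe1988, §5.14 p.311] -/
theorem run_rest_subset (g : LGrp S κ) (rest : Finset κ) (done : Multiset (LGrp S κ)) :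
    ∀ o ∈ run A f c legs obs M g rest done, o.rest ⊆ rest := by
  refine run_ind' (P := fun _ rest _ o => o.rest ⊆ rest) (fun _ _ _ _ => subset_rfl) ?_ ?_ ?_ ?_ ?_ ?_ g rest done
  · intro g rest done u L _ _ i o _ h; exact h
  · intro g rest done u L _ _ j _ i o _ h; exact h.trans (Finset.erase_subset _ _)
  · intro g rest done u L _ _ h _ i _ o _ h'; exact h'
  · intro g rest done u L _ _ o _ h; exact h
  · intro g rest done u L _ _ o _ h; exact h
  · intro g rest done u L _ _ m j o _ h; exact h

/-- **The untouched complete components of an outcome were set aside before.** [cite: BalabanImbrieJaffe1988, §5.14 p.311] -/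
theorem run_done_le (g : LGrp S κ) (rest : Finset κ) (done : Multiset (LGrp S κ)) :
    ∀ o ∈ run A f c legs obs M g rest done, o.done ≤ done := by
  refine run_ind' (P := fun _ _ done o => o.done ≤ done) (fun _ _ _ _ => le_rfl) ?_ ?_ ?_ ?_ ?_ ?_ g rest done
  · intro g rest done u L _ _ i o _ h; exact h
  · intro g rest done u L _ _ j _ i o _ h; exact h
  · intro g rest done u L _ _ h _ i _ o _ h'; exact h'.trans (Multiset.erase_le _ _)
  · intro g rest done u L _ _ o _ h; exact h
  · intro g rest done u L _ _ o _ h; exact h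
  · intro g rest done u L _ _ m j o _ h; exact h

/-- **Every outcome's component is complete** (*"We stop integrating by parts fields in complete components"*).
[cite: BalabanImbrieJaffe1988, §5.14 p.311] -/
theorem run_complete (g : LGrp S κ) (rest : Finset κ) (done : Multiset (LGrp S κ)) :
    ∀ o ∈ run A f c legs obs M g rest done, o.g.complete M = true := by
  refine run_ind' (P := fun _ _ _ o => o.g.complete M = true) (fun _ _ _ h => h) ?_ ?_ ?_ ?_ ?_ ?_ g rest done
  · intro g rest done u L _ _ i o _ h; exact h
  · intro g rest done u L _ _ j _ i o _ h; exact h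
  · intro g rest done u L _ _ h _ i _ o _ h'; exact h'
  · intro g rest done u L _ _ o _ h; exact h
  · intro g rest done u L _ _ o _ h; exact h
  · intro g rest done u L _ _ m j o _ h; exact h

/-- **The `χ′`-count, the vertex count and the label set of the component only grow along a run.**
[cite: BalabanImbrieJaffe1988, §5.14 p.311] -/
theorem run_mono (g : LGrp S κ) (rest : Finset κ) (done : Multiset (LGrp S κ)) :
    ∀ o ∈ run A f c legs obs M g rest done, g.nchi ≤ o.g.nchi ∧ g.nv ≤ o.g.nv ∧ g.lab ⊆ o.g.lab := by
  refine run_ind' (P := fun g _ _ o => g.nchi ≤ o.g.nchi ∧ g.nv ≤ o.g.nv ∧ g.lab ⊆ o.g.lab)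
    (fun _ _ _ _ => ⟨le_rfl, le_rfl, subset_rfl⟩) ?_ ?_ ?_ ?_ ?_ ?_ g rest done
  · intro g rest done u L _ _ i o _ h; exact h
  · intro g rest done u L _ _ j _ i o _ h
    exact ⟨h.1, h.2.1, (Finset.subset_union_left).trans h.2.2⟩
  · intro g rest done u L _ _ h _ i _ o _ h'
    simp only [LGrp.absorb, Outcome.scale_g] at h' ⊢
    exact ⟨le_of_add_le_left h'.1, le_of_add_le_left h'.2.1, (Finset.subset_union_left).trans h'.2.2⟩
  · intro g rest done u L _ _ o _ h; exact h
  · intro g rest done u L _ _ o _ h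
    exact ⟨Nat.le_of_succ_le h.1, h.2.1, h.2.2⟩
  · intro g rest done u L _ _ m j o _ h
    exact ⟨h.1, Nat.le_of_succ_le h.2.1, h.2.2⟩

omit [Fintype S] [DecidableEq S] [DecidableEq κ] in
/-- A complete component with a pending leg is a remainder component (its counts say so).
[cite: BalabanImbrieJaffe1988, §5.14 p.311] -/
theorem isRem_of_complete_of_lt {h : LGrp S κ} (hc : h.complete M = true) {i : ℕ} (hi : i < h.pend.length) :
    0 < h.nchi ∨ M ≤ h.nv := by
  have hne : h.pend ≠ [] := by
    intro h0; rw [h0] at hi; exact Nat.not_lt_zero _ hi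
  simp only [Grp.complete, Bool.or_eq_true, List.isEmpty_iff, decide_eq_true_eq] at hc
  rcases hc with (hc | hc) | hc
  · exact absurd hc hne
  · exact Or.inl hc
  · exact Or.inr hc

/-- **A CONSTANT OUTCOME MADE NO CONTRACTION TO `χ′` AND ABSORBED NO COMPLETE COMPONENT**: if the complete components
set aside are complete (as they are) and the outcome's component is constant (no `χ′`, fewer than `M` vertices, no
pending leg), then the run produced no `χ′`-direction and left `done` untouched — constant components are built from
pristine observables only (*"the {X_c} are determined once the remainder components are specified"*).
[cite: BalabanImbrieJaffe1988, §5.14 p.311–312] -/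
theorem run_const (g : LGrp S κ) (rest : Finset κ) (done : Multiset (LGrp S κ)) :
    ∀ o ∈ run A f c legs obs M g rest done, (∀ h ∈ done, h.complete M = true) → o.g.IsConst M →
      o.D = [] ∧ o.done = done := by
  refine run_ind' (P := fun _ _ done o => (∀ h ∈ done, h.complete M = true) → o.g.IsConst M → o.D = [] ∧ o.done = done)
    (fun _ _ _ _ _ _ => ⟨rfl, rfl⟩) ?_ ?_ ?_ ?_ ?_ ?_ g rest done
  · intro g rest done u L _ _ i o _ h; exact h
  · intro g rest done u L _ _ j _ i o _ h; exact h
  · intro g rest done u L _ _ h hh i hi o ho _ hd hconst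
    -- absorbing a complete component with a pending leg makes the component a remainder one: no constant outcome
    exfalso
    have hr := isRem_of_complete_of_lt (hd h hh) hi
    have hm := run_mono _ _ _ o ho
    simp only [LGrp.absorb, Outcome.scale_g] at hm hconst
    rcases hconst with ⟨-, h0, hlt⟩
    rcases hr with hr | hr <;> omega
  · intro g rest done u L _ _ o _ h; exact h
  · intro g rest done u L _ _ o ho _ hd hconst
    -- a contraction to χ′ makes the component a remainder one: no constant outcome
    exfalso
    have hm := run_mono _ _ _ o ho
    simp only [Outcome.push_g] at hconst
    rcases hconst with ⟨-, h0, -⟩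
    simp only at hm
    omega
  · intro g rest done u L _ _ m j o _ h; exact h

/-- **Label bookkeeping**: the labels of the component, of the complete components set aside and the untouched
observables are conserved along a run. [cite: BalabanImbrieJaffe1988, §5.14 p.311] -/
theorem run_lab (g : LGrp S κ) (rest : Finset κ) (done : Multiset (LGrp S κ)) :
    ∀ o ∈ run A f c legs obs M g rest done,
      o.g.lab ∪ (o.done.map LGrp.lab).sup ∪ o.rest = g.lab ∪ (done.map LGrp.lab).sup ∪ rest := by
  refine run_ind' (P := fun g rest done o =>
      o.g.lab ∪ (o.done.map LGrp.lab).sup ∪ o.rest = g.lab ∪ (done.map LGrp.lab).sup ∪ rest)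
    (fun _ _ _ _ => rfl) ?_ ?_ ?_ ?_ ?_ ?_ g rest done
  · intro g rest done u L _ _ i o _ h; exact h
  · intro g rest done u L _ _ j hj i o _ h
    rw [Outcome.scale_g, Outcome.scale_done, Outcome.scale_rest, h]
    conv_rhs => rw [← Finset.insert_erase hj]
    ext x; simp only [Finset.mem_union, Finset.mem_singleton, Finset.mem_insert]; tauto
  · intro g rest done u L _ _ h hh i _ o _ h'
    rw [Outcome.scale_g, Outcome.scale_done, Outcome.scale_rest, h']
    conv_rhs => rw [← Multiset.cons_erase hh]
    simp only [LGrp.absorb, Multiset.map_cons, Multiset.sup_cons]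
    ext x; simp only [Finset.mem_union, Finset.sup_eq_union]; tauto
  · intro g rest done u L _ _ o _ h; exact h
  · intro g rest done u L _ _ o _ h; exact h
  · intro g rest done u L _ _ m j o _ h; exact h

end Invariants

/-! ## §4  The environment lemmas -/

section Env

variable {A : Matrix S S ℝ} {f : S → ℝ} {c : ι → ℝ} {legs : ι → List (S → ℝ)} {obs : κ → List (S → ℝ)} {M : ℕ}


omit [Fintype S] [DecidableEq S] in
/-- The sub-environment after one pristine observable is used up. [cite: BalabanImbrieJaffe1988, §5.14 p.311] -/
theorem erase_sdiff_erase_eq {rest B : Finset κ} {j : κ} (hj : j ∈ B) : rest.erase j \ B.erase j = rest \ B := by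
  ext x
  simp only [Finset.mem_sdiff, Finset.mem_erase, not_and, ne_eq]
  constructor
  · rintro ⟨⟨hx, hxr⟩, h⟩
    exact ⟨hxr, fun hxB => h hx hxB⟩
  · rintro ⟨hxr, hxB⟩
    have hx : x ≠ j := fun h => hxB (h ▸ hj)
    exact ⟨⟨hx, hxr⟩, fun _ => hxB⟩

/-- **ENVIRONMENT LEMMA I — a run sees only the observables it touches**: for a sub-environment `B ⊆ rest`, the
outcomes of the run in `rest` that leave `rest ∖ B` untouched are exactly the outcomes of the run in `B`, with `rest ∖ B`
put back into the environment (same weights, directions, vertices, component, complete components).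
[cite: BalabanImbrieJaffe1988, §5.14 p.311–312] -/
theorem run_filter_env : ∀ (n : ℕ) (g : LGrp S κ) (rest : Finset κ) (done : Multiset (LGrp S κ)),
    rpot obs M (maxArity legs) g rest done < n → ∀ (B : Finset κ), B ⊆ rest →
      (run A f c legs obs M g rest done).filter (fun o => rest \ B ⊆ o.rest)
        = (run A f c legs obs M g B done).map (fun o => { o with rest := o.rest ∪ (rest \ B) })
  | 0, _, _, _, hn => fun _ _ => absurd hn (Nat.not_lt_zero _)
  | n + 1, g, rest, done, hn => by
    intro B hB
    have hn' : rpot obs M (maxArity legs) g rest done ≤ n := Nat.lt_succ_iff.1 hn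
    have IH : ∀ g' rest' done', rpot obs M (maxArity legs) g' rest' done' < rpot obs M (maxArity legs) g rest done →
        ∀ (B' : Finset κ), B' ⊆ rest' → (run A f c legs obs M g' rest' done').filter (fun o => rest' \ B' ⊆ o.rest)
          = (run A f c legs obs M g' B' done').map (fun o => { o with rest := o.rest ∪ (rest' \ B') }) :=
      fun g' rest' done' hlt => run_filter_env n g' rest' done' (lt_of_lt_of_le hlt hn')
    by_cases hc : g.complete M = true
    · rw [run_of_complete A f c legs obs M hc, run_of_complete A f c legs obs M hc, Multiset.map_singleton,
        Multiset.filter_singleton, if_pos (Finset.sdiff_subset : rest \ B ⊆ rest)]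
      simp only [Finset.union_sdiff_of_subset hB]
    · obtain ⟨u, L, hp⟩ := List.exists_cons_of_ne_nil (Grp.pend_ne_nil_of_not_complete hc)
      have hnv : g.nv < M := Grp.nv_lt_of_not_complete hc
      rw [run_of_not_complete A f c legs obs M hc hp rest done, run_of_not_complete A f c legs obs M hc hp B done]
      simp only [Multiset.filter_add, Multiset.map_add, filter_bind, Multiset.map_bind, filter_fbind, map_fbind,
        filter_mbind, map_mbind, Multiset.filter_map, Multiset.map_map, Function.comp_def, Outcome.scale_rest,
        Outcome.push_rest, Outcome.bump_rest]
      refine congrArg₂ (· + ·) (congrArg₂ (· + ·) (congrArg₂ (· + ·) (congrArg₂ (· + ·) (congrArg₂ (· + ·)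
        ?_ ?_) ?_) ?_) ?_) ?_
      · -- (1) inside the component
        refine Multiset.bind_congr fun i _ => ?_
        rw [IH _ _ _ (rpot_pair obs M _ rest done hp i) _ hB, Multiset.map_map]
        rfl
      · -- (2) a pristine observable joins: it must lie in `B`
        rw [fbind_eq_fbind_subset hB _ (fun j => (range (obs j).length).val.bind fun i =>
            ((run A f c legs obs M ⟨⟨L ++ (obs j).eraseIdx i, g.nchi, g.nv⟩, g.lab ∪ {j}⟩ (rest.erase j) done).filter
              fun o => rest \ B ⊆ o.rest).map (Outcome.scale ((A⁻¹ *ᵥ u) ⬝ᵥ (obs j).getD i 0)))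
            (fun j _ => rfl) ?_]
        · refine fbind_congr fun j hj => Multiset.bind_congr fun i _ => ?_
          have h := IH _ _ _ (rpot_pristine obs M _ rest done hp (hB hj) i (g.lab ∪ {j})) _ (Finset.erase_subset_erase j hB)
          rw [erase_sdiff_erase_eq hj] at h
          rw [h, Multiset.map_map]
          rfl
        · intro j hj hjB
          refine bind_eq_zero fun i _ => ?_
          rw [Multiset.filter_eq_nil.2, Multiset.map_zero]
          intro o ho hsub
          have h1 := run_rest_subset _ _ _ o ho (hsub (Finset.mem_sdiff.2 ⟨hj, hjB⟩))
          exact (Finset.notMem_erase j rest) h1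
      · -- (3) a complete component joins
        refine mbind_congr fun h hh => Multiset.bind_congr fun i _ => ?_
        rw [IH _ _ _ (rpot_absorb obs M _ rest done hp hh i) _ hB, Multiset.map_map]
        rfl
      · -- (4) the source
        rw [IH _ _ _ (rpot_drop obs M _ rest done hp _) _ hB, Multiset.map_map]
        rfl
      · -- (5) χ′
        rw [IH _ _ _ (rpot_drop obs M _ rest done hp _) _ hB, Multiset.map_map]
        rfl
      · -- (6) a vertex
        refine Multiset.bind_congr fun m _ => Multiset.bind_congr fun j _ => ?_
        rw [IH _ _ _ (rpot_vertex obs M rest done legs hp hnv m j) _ hB, Multiset.map_map]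
        rfl

/-- **ENVIRONMENT LEMMA II — constant outcomes do not see the complete components set aside**: if the components in
`done` are complete, the constant outcomes of the run with `done` are the constant outcomes of the run with no
component set aside, `done` put back (a constant component is built from pristine observables only: absorbing a
complete component with a pending leg, or contracting to `χ′`, makes the component a remainder one).
[cite: BalabanImbrieJaffe1988, §5.14 p.311–312] -/
theorem run_filter_const : ∀ (n : ℕ) (g : LGrp S κ) (rest : Finset κ) (done : Multiset (LGrp S κ)),
    rpot obs M (maxArity legs) g rest done < n → (∀ h ∈ done, h.complete M = true) →
      (run A f c legs obs M g rest done).filter (fun o => o.g.IsConst M)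
        = ((run A f c legs obs M g rest 0).filter (fun o => o.g.IsConst M)).map (fun o => { o with done := done })
  | 0, _, _, _, hn => absurd hn (Nat.not_lt_zero _)
  | n + 1, g, rest, done, hn => by
    intro hd
    have hn' : rpot obs M (maxArity legs) g rest done ≤ n := Nat.lt_succ_iff.1 hn
    have IH : ∀ g' rest' done', rpot obs M (maxArity legs) g' rest' done' < rpot obs M (maxArity legs) g rest done →
        (∀ h ∈ done', h.complete M = true) → (run A f c legs obs M g' rest' done').filter (fun o => o.g.IsConst M)
          = ((run A f c legs obs M g' rest' 0).filter (fun o => o.g.IsConst M)).map (fun o => { o with done := done' }) :=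
      fun g' rest' done' hlt => run_filter_const n g' rest' done' (lt_of_lt_of_le hlt hn')
    by_cases hc : g.complete M = true
    · rw [run_of_complete A f c legs obs M hc, run_of_complete A f c legs obs M hc, Multiset.filter_singleton,
        Multiset.filter_singleton]
      by_cases hg : g.IsConst M
      · rw [if_pos hg, if_pos hg, Multiset.map_singleton]
      · rw [if_neg hg, if_neg hg]
        rfl
    · obtain ⟨u, L, hp⟩ := List.exists_cons_of_ne_nil (Grp.pend_ne_nil_of_not_complete hc)
      have hnv : g.nv < M := Grp.nv_lt_of_not_complete hc
      rw [run_of_not_complete A f c legs obs M hc hp rest done, run_of_not_complete A f c legs obs M hc hp rest 0]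
      simp only [Multiset.filter_add, Multiset.map_add, filter_bind, Multiset.map_bind, filter_fbind, map_fbind,
        filter_mbind, Multiset.filter_map, Multiset.map_map, Function.comp_def, Outcome.scale_g,
        Outcome.push_g, Outcome.bump_g, mbind_zero]
      refine congrArg₂ (· + ·) (congrArg₂ (· + ·) (congrArg₂ (· + ·) (congrArg₂ (· + ·) (congrArg₂ (· + ·)
        ?_ ?_) ?_) ?_) ?_) ?_
      · refine Multiset.bind_congr fun i _ => ?_
        rw [IH _ _ _ (rpot_pair obs M _ rest done hp i) hd, Multiset.map_map]
        rfl
      · refine fbind_congr fun j hj => Multiset.bind_congr fun i _ => ?_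
        rw [IH _ _ _ (rpot_pristine obs M _ rest done hp hj i (g.lab ∪ {j})) hd, Multiset.map_map]
        rfl
      · -- (3) absorbing a complete component never yields a constant outcome
        refine mbind_eq_zero fun h hh => bind_eq_zero fun i hi => ?_
        rw [Multiset.filter_eq_nil.2, Multiset.map_zero]
        intro o ho hconst
        have hi' : i < h.pend.length := by simpa using hi
        have hr := isRem_of_complete_of_lt (hd h hh) hi'
        have hm := run_mono _ _ _ o ho
        simp only [LGrp.absorb] at hm
        rcases hconst with ⟨-, h0, hlt⟩
        rcases hr with hr | hr <;> omega
      · rw [IH _ _ _ (rpot_drop obs M _ rest done hp _) hd, Multiset.map_map]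
        rfl
      · rw [IH _ _ _ (rpot_drop obs M _ rest done hp _) hd, Multiset.map_map]
        rfl
      · refine Multiset.bind_congr fun m _ => Multiset.bind_congr fun j _ => ?_
        rw [IH _ _ _ (rpot_vertex obs M rest done legs hp hnv m j) hd, Multiset.map_map]
        rfl

end Env

end Literature.MathematicalPhysics.QuantumFieldTheory.BalabanImbrieJaffe1984to88.BIJ88LabelledRunEnv311

end
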